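import Summits.CriticalPhenomena.PercolationContinuityZ3.Theorems.PercNearOneGluingNoHeavyLowerTailForestRayleighTreewidthTwo
import HarnessLib

/-!
# Weighted forest negative correlation on graphs of tree-width ≤ 2 — XI: the Grimmett–Winkler / Kahn inequality at unit weights (counting form)

For a finite simple graph `E` of tree-width ≤ 2 (inside an edge system `T` with an elimination
order `ρ` as in `forestsW_rayleigh_of_elimOrder`) and two edges `e ≠ f` of `E`, the uniform random
spanning forest `F` of `E` satisfies the negative-correlation inequality

  `#{F : e, f ∈ F} · #{F} ≤ #{F : e ∈ F} · #{F : f ∈ F}`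

(`forests_negCorr_of_elimOrder`; all `F ⊆ E` with `⟨F⟩` acyclic). This is Conjecture 1.1 of
Semple–Welsh (Kahn 2000; Grimmett–Winkler 2004) for the class, i.e. the graphic, unit-weight
case of Semple–Welsh, CPC 17 (2008), Thm. 4.4; it is the specialisation `w ≡ 1`, `K = ∅` of the
pinned Rayleigh inequality, rewritten through the four-way split of the forests of `E` by
`e ∈ F`, `f ∈ F` (S–W Lemma 3.1). Theorems only; no definitions, no `sorry`.
-/

open Finset SimpleGraph

namespace Summit.CriticalPhenomena.PercolationContinuityZ3.Theorems.ForestRayleigh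

/-! ### §1 Counting subsets through one coordinate -/

section Abstract

variable {α : Type*} [DecidableEq α]

/-- `#{F ⊆ E : Q F, e ∈ F} = #{G ⊆ E ∖ e : Q (G ∪ e)}` (`F ↦ F ∖ e`). [elementary] -/
theorem card_filter_and_mem (Q : Finset α → Prop) [DecidablePred Q] (E : Finset α) {e : α}
    (he : e ∈ E) :
    #(E.powerset.filter fun F => Q F ∧ e ∈ F) =
      #((E.erase e).powerset.filter fun G => Q (insert e G)) := by
  refine Finset.card_bij' (fun F _ => F.erase e) (fun G _ => insert e G) ?_ ?_ ?_ ?_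
  · intro F hF
    simp only [Finset.mem_filter, Finset.mem_powerset] at hF ⊢
    refine ⟨fun x hx => Finset.mem_erase.2 ⟨(Finset.mem_erase.1 hx).1, hF.1 (Finset.mem_erase.1 hx).2⟩,
      ?_⟩
    rw [Finset.insert_erase hF.2.2]; exact hF.2.1
  · intro G hG
    simp only [Finset.mem_filter, Finset.mem_powerset] at hG ⊢
    refine ⟨Finset.insert_subset he fun x hx => Finset.mem_of_mem_erase (hG.1 hx), hG.2,
      Finset.mem_insert_self _ _⟩
  · intro F hF
    simp only [Finset.mem_filter] at hF
    exact Finset.insert_erase hF.2.2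
  · intro G hG
    simp only [Finset.mem_filter, Finset.mem_powerset] at hG
    exact Finset.erase_insert fun hh => Finset.notMem_erase e E (hG.1 hh)

/-- `#{F ⊆ E : Q F, e ∉ F} = #{G ⊆ E ∖ e : Q G}`. [elementary] -/
theorem card_filter_and_not_mem (Q : Finset α → Prop) [DecidablePred Q] (E : Finset α) (e : α) :
    #(E.powerset.filter fun F => Q F ∧ e ∉ F) = #((E.erase e).powerset.filter fun G => Q G) := by
  congr 1
  ext F
  simp only [Finset.mem_filter, Finset.mem_powerset, Finset.subset_erase]
  tauto

/-- `#{F ⊆ E : Q F} = #{Q, e ∈ F} + #{Q, e ∉ F}`. [elementary] -/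
theorem card_filter_split_mem (Q : Finset α → Prop) [DecidablePred Q] (E : Finset α) (e : α) :
    #(E.powerset.filter fun F => Q F) =
      #(E.powerset.filter fun F => Q F ∧ e ∈ F) + #(E.powerset.filter fun F => Q F ∧ e ∉ F) := by
  rw [← Finset.filter_filter, ← Finset.filter_filter, Finset.card_filter_add_card_filter_not]

omit [DecidableEq α] in
/-- The algebra of Semple–Welsh's Lemma 3.1 at the level of counts: `d a ≤ c b` gives
`d (d + c + (b + a)) ≤ (d + c)(d + b)`. [elementary] -/
theorem negCorr_of_rayleigh_counts {a b c d : ℕ} (h : d * a ≤ c * b) :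
    d * (d + c + (b + a)) ≤ (d + c) * (d + b) := by nlinarith [h]

end Abstract

/-! ### §2 The inequality -/

section Forests
open scoped Classical

variable {V : Type*} [Fintype V] [DecidableEq V]

/-- **Negative correlation of the uniform random spanning forest on graphs of tree-width ≤ 2**
(Grimmett–Winkler / Kahn inequality, counting form): for `E ⊆ T` (`T, ρ` as in
`forestsW_rayleigh_of_elimOrder`) and edges `e ≠ f` of `E`,
`#{F : e,f ∈ F}·#{F} ≤ #{F : e ∈ F}·#{F : f ∈ F}` over the forests `F ⊆ E`.
[Semple–Welsh, CPC 17 (2008), Thm. 4.4 (graphic, unit weights); Kahn 2000 / Grimmett–Winkler 2004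
conjecture for this class] -/
theorem forests_negCorr_of_elimOrder (T : Finset (Sym2 V)) (ρ : V → ℕ)
    (hρ : ∀ u v : V, s(u, v) ∈ T → ρ u ≠ ρ v)
    (h2 : ∀ v u₁ u₂ u₃ : V, s(v, u₁) ∈ T → s(v, u₂) ∈ T → s(v, u₃) ∈ T →
      ρ v < ρ u₁ → ρ v < ρ u₂ → ρ v < ρ u₃ → u₁ = u₂ ∨ u₁ = u₃ ∨ u₂ = u₃)
    (hfill : ∀ v u₁ u₂ : V, s(v, u₁) ∈ T → s(v, u₂) ∈ T → ρ v < ρ u₁ → ρ v < ρ u₂ →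
      u₁ ≠ u₂ → s(u₁, u₂) ∈ T)
    (E : Finset (Sym2 V)) (hE : E ⊆ T) {e f : Sym2 V} (he : e ∈ E) (hf : f ∈ E) (hef : e ≠ f) :
    #(E.powerset.filter fun F : Finset (Sym2 V) =>
        (fromEdgeSet ((F : Finset (Sym2 V)) : Set (Sym2 V))).IsAcyclic ∧ e ∈ F ∧ f ∈ F) *
      #(E.powerset.filter fun F : Finset (Sym2 V) =>
        (fromEdgeSet ((F : Finset (Sym2 V)) : Set (Sym2 V))).IsAcyclic) ≤
    #(E.powerset.filter fun F : Finset (Sym2 V) =>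
        (fromEdgeSet ((F : Finset (Sym2 V)) : Set (Sym2 V))).IsAcyclic ∧ e ∈ F) *
      #(E.powerset.filter fun F : Finset (Sym2 V) =>
        (fromEdgeSet ((F : Finset (Sym2 V)) : Set (Sym2 V))).IsAcyclic ∧ f ∈ F) := by
  -- the four counts over `D = E ∖ {e, f}`
  have hfe : f ∈ E.erase e := Finset.mem_erase.2 ⟨hef.symm, hf⟩
  have heD : e ∉ (E.erase e).erase f := fun hh => Finset.notMem_erase e E (Finset.mem_of_mem_erase hh)
  have hfD : f ∉ (E.erase e).erase f := Finset.notMem_erase _ _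
  -- N_ef
  have nef : #(E.powerset.filter fun F : Finset (Sym2 V) =>
        (fromEdgeSet ((F : Finset (Sym2 V)) : Set (Sym2 V))).IsAcyclic ∧ e ∈ F ∧ f ∈ F) =
      #(((E.erase e).erase f).powerset.filter fun G : Finset (Sym2 V) =>
        (fromEdgeSet ((insert e (insert f G) : Finset (Sym2 V)) : Set (Sym2 V))).IsAcyclic) := by
    have c₁ : (E.powerset.filter fun F : Finset (Sym2 V) => (fromEdgeSet ((F : Finset (Sym2 V)) : Set (Sym2 V))).IsAcyclic ∧ e ∈ F ∧ f ∈ F) =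
        E.powerset.filter fun F : Finset (Sym2 V) => ((fromEdgeSet ((F : Finset (Sym2 V)) : Set (Sym2 V))).IsAcyclic ∧ f ∈ F) ∧ e ∈ F :=
      Finset.filter_congr fun F _ => ⟨fun hh => ⟨⟨hh.1, hh.2.2⟩, hh.2.1⟩, fun hh => ⟨hh.1.1, hh.2, hh.1.2⟩⟩
    rw [c₁, card_filter_and_mem (fun F : Finset (Sym2 V) => (fromEdgeSet ((F : Finset (Sym2 V)) : Set (Sym2 V))).IsAcyclic ∧ f ∈ F) E he]
    have c₂ : ((E.erase e).powerset.filter fun G : Finset (Sym2 V) =>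
        (fromEdgeSet ((insert e G : Finset (Sym2 V)) : Set (Sym2 V))).IsAcyclic ∧ f ∈ insert e G) =
        (E.erase e).powerset.filter fun G : Finset (Sym2 V) =>
          (fromEdgeSet ((insert e G : Finset (Sym2 V)) : Set (Sym2 V))).IsAcyclic ∧ f ∈ G :=
      Finset.filter_congr fun G _ => by
        rw [Finset.mem_insert, or_iff_right hef.symm]
    rw [c₂, card_filter_and_mem (fun G : Finset (Sym2 V) =>
      (fromEdgeSet ((insert e G : Finset (Sym2 V)) : Set (Sym2 V))).IsAcyclic) (E.erase e) hfe]
  -- N_e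
  have ne : #(E.powerset.filter fun F : Finset (Sym2 V) =>
        (fromEdgeSet ((F : Finset (Sym2 V)) : Set (Sym2 V))).IsAcyclic ∧ e ∈ F) =
      #(((E.erase e).erase f).powerset.filter fun G : Finset (Sym2 V) =>
        (fromEdgeSet ((insert e (insert f G) : Finset (Sym2 V)) : Set (Sym2 V))).IsAcyclic) +
      #(((E.erase e).erase f).powerset.filter fun G : Finset (Sym2 V) =>
        (fromEdgeSet ((insert e G : Finset (Sym2 V)) : Set (Sym2 V))).IsAcyclic) := by
    rw [card_filter_and_mem (fun F : Finset (Sym2 V) => (fromEdgeSet ((F : Finset (Sym2 V)) : Set (Sym2 V))).IsAcyclic) E he,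
      card_filter_split_mem _ (E.erase e) f,
      card_filter_and_mem (fun G : Finset (Sym2 V) =>
        (fromEdgeSet ((insert e G : Finset (Sym2 V)) : Set (Sym2 V))).IsAcyclic) (E.erase e) hfe,
      card_filter_and_not_mem (fun G : Finset (Sym2 V) =>
        (fromEdgeSet ((insert e G : Finset (Sym2 V)) : Set (Sym2 V))).IsAcyclic) (E.erase e) f]
  -- N_f
  have hef' : e ∈ E.erase f := Finset.mem_erase.2 ⟨hef, he⟩
  have hDD : (E.erase f).erase e = (E.erase e).erase f := Finset.erase_right_comm
  have nf : #(E.powerset.filter fun F : Finset (Sym2 V) =>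
        (fromEdgeSet ((F : Finset (Sym2 V)) : Set (Sym2 V))).IsAcyclic ∧ f ∈ F) =
      #(((E.erase e).erase f).powerset.filter fun G : Finset (Sym2 V) =>
        (fromEdgeSet ((insert e (insert f G) : Finset (Sym2 V)) : Set (Sym2 V))).IsAcyclic) +
      #(((E.erase e).erase f).powerset.filter fun G : Finset (Sym2 V) =>
        (fromEdgeSet ((insert f G : Finset (Sym2 V)) : Set (Sym2 V))).IsAcyclic) := by
    rw [card_filter_and_mem (fun F : Finset (Sym2 V) => (fromEdgeSet ((F : Finset (Sym2 V)) : Set (Sym2 V))).IsAcyclic) E hf,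
      card_filter_split_mem _ (E.erase f) e,
      card_filter_and_mem (fun G : Finset (Sym2 V) =>
        (fromEdgeSet ((insert f G : Finset (Sym2 V)) : Set (Sym2 V))).IsAcyclic) (E.erase f) hef',
      card_filter_and_not_mem (fun G : Finset (Sym2 V) =>
        (fromEdgeSet ((insert f G : Finset (Sym2 V)) : Set (Sym2 V))).IsAcyclic) (E.erase f) e, hDD]
    simp only [Finset.insert_comm f e]
  -- N
  have nn : #(E.powerset.filter fun F : Finset (Sym2 V) =>
        (fromEdgeSet ((F : Finset (Sym2 V)) : Set (Sym2 V))).IsAcyclic) =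
      (#(((E.erase e).erase f).powerset.filter fun G : Finset (Sym2 V) =>
        (fromEdgeSet ((insert e (insert f G) : Finset (Sym2 V)) : Set (Sym2 V))).IsAcyclic) +
      #(((E.erase e).erase f).powerset.filter fun G : Finset (Sym2 V) =>
        (fromEdgeSet ((insert e G : Finset (Sym2 V)) : Set (Sym2 V))).IsAcyclic)) +
      (#(((E.erase e).erase f).powerset.filter fun G : Finset (Sym2 V) =>
        (fromEdgeSet ((insert f G : Finset (Sym2 V)) : Set (Sym2 V))).IsAcyclic) +
      #(((E.erase e).erase f).powerset.filter fun G : Finset (Sym2 V) =>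
        (fromEdgeSet ((G : Finset (Sym2 V)) : Set (Sym2 V))).IsAcyclic)) := by
    rw [card_filter_split_mem _ E e, ne, card_filter_and_not_mem _ E e,
      card_filter_split_mem _ (E.erase e) f,
      card_filter_and_mem (fun G : Finset (Sym2 V) => (fromEdgeSet ((G : Finset (Sym2 V)) : Set (Sym2 V))).IsAcyclic) (E.erase e) hfe,
      card_filter_and_not_mem (fun G : Finset (Sym2 V) => (fromEdgeSet ((G : Finset (Sym2 V)) : Set (Sym2 V))).IsAcyclic) (E.erase e) f]
  -- the unit-weight Rayleigh inequality on `D`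
  have ray := forestsW_rayleigh_of_elimOrder T ρ hρ h2 hfill (fun _ => (1 : ℝ)) (fun _ => zero_le_one)
    ((E.erase e).erase f) ∅ e f
    (by
      intro x hx
      rcases Finset.mem_union.1 hx with hx | hx
      · exact hE (Finset.mem_of_mem_erase (Finset.mem_of_mem_erase hx))
      · simp only [Finset.mem_insert, Finset.notMem_empty, or_false] at hx
        rcases hx with rfl | rfl
        · exact hE he
        · exact hE hf)
    (Finset.disjoint_empty_right _) heD (Finset.notMem_empty _) hfD (Finset.notMem_empty _) hef
  simp only [Finset.prod_const_one, Finset.sum_const, nsmul_eq_mul, mul_one, Finset.union_insert,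
    Finset.union_empty] at ray
  rw [nef, ne, nf, nn]
  refine negCorr_of_rayleigh_counts ?_
  exact_mod_cast ray

end Forests


end Summit.CriticalPhenomena.PercolationContinuityZ3.Theorems.ForestRayleigh
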